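import Summits.CriticalPhenomena.PercolationContinuityZ3.Theorems.PercNearOneGluingNoHeavyLowerTailNineTypeTwins
import Summits.CriticalPhenomena.PercolationContinuityZ3.Theorems.PercNearOneGluingNoHeavyLowerTailNineTypeRectangle

/-!
# Nine-type configurations: the join lemma (fifth circuit class of conjecture K1)

Abstract setting of `NineType.twins_L_row_not_H_combination`: a typed family `𝒯` of subsets of a finite
type (`θ s ∈ {1,…,9}`; free types `5, 7`, top types `8, 9`) with CONT, COV, and an up-set `𝔊` containing
the HL-forced goods `s ∪ s'ᶜ` and the HH-forced goods `s ∪ s'`.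

A **join** is a dependency among H-rows of the shape `[a ⊆ g] = [q₁ ⊆ g] + [q₂ ⊆ g] + [q₁ ∪ q₂ ⊆ g]`
on `𝔊`, i.e. `a ⊆ g ↔ (q₁ ⊆ g ∨ q₂ ⊆ g)` for every good `g`, with `q₁, q₂` free and `⊆`-incomparable,
`t = q₁ ∪ q₂ ∈ 𝒯` free (the top) and `a` of type `8/9`.  The **join lemma** says that the L-row of the
top, `g ↦ [tᶜ ⊆ g]`, is not a `GF(2)`-combination of H-rows `g ↦ [s ⊆ g]`, `s ∈ 𝒯`.  The certificate is
the H-row of the anchor `a` itself: `#{g ∈ 𝔊 : a ∪ s ⊆ g}` is even for every point `s` while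
`#{g ∈ 𝔊 : a ∪ tᶜ ⊆ g}` is odd (`prim-bnk-1` gen 18 memo §12).

Main results: `NineType.parity_certificate`, `NineType.two_filter_parity`, `NineType.join_core`,
`NineType.join_no_top_point`, `NineType.join_dichotomy`, **`NineType.join_L_row_not_H_combination`**.
-/

namespace Summit.CriticalPhenomena.PercolationContinuityZ3.Theorems

namespace NineType

open Finset

/-- Table fact: the top types `8, 9` are HH-compatible with the free types `5, 7`. -/
theorem join_table_hh_89_free : ∀ a : ℕ, (a = 8 ∨ a = 9) → ∀ t : ℕ, (t = 5 ∨ t = 7) → hhOK a t = true := by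
  intro a ha t ht
  rcases ha with rfl | rfl <;> rcases ht with rfl | rfl <;> decide

/-- Table fact: the top types `8, 9` are HL-compatible with the anchored low types `1, 2, 3, 4, 6`. -/
theorem join_table_hl_89_low : ∀ a : ℕ, (a = 8 ∨ a = 9) → ∀ s : ℕ, 1 ≤ s → s ≤ 7 → s ≠ 5 → s ≠ 7 →
    hlOK a s = true := by
  intro a ha s hs1 hs7 hs5 hs7'
  rcases ha with rfl | rfl <;> interval_cases s <;> first | decide | exact absurd rfl hs5 | exact absurd rfl hs7'

variable {α : Type*} [DecidableEq α] [Fintype α]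

/-- **Parity certificate** (generic form of the filter / interval / H-row certificates): if the goods above
`U ∪ tᶜ` are odd in number while for every `s ∈ S` the goods above `U ∪ s` are even in number, then the
relation `#{s ∈ S : s ⊆ g} ≡ [tᶜ ⊆ g]` cannot hold for every good `g` — sum it over the goods above `U`.
[this work, memo §12/§13] -/
theorem parity_certificate (𝔊 : Finset (Finset α)) (U t : Finset α) (S : Finset (Finset α))
    (hodd : ((#(𝔊.filter (fun u => U ∪ tᶜ ⊆ u)) : ℕ) : ZMod 2) = 1)
    (heven : ∀ s ∈ S, ((#(𝔊.filter (fun u => U ∪ s ⊆ u)) : ℕ) : ZMod 2) = 0) :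
    ¬ (∀ g ∈ 𝔊, ((#(S.filter (fun s => s ⊆ g)) : ℕ) : ZMod 2) = if tᶜ ⊆ g then 1 else 0) := by
  intro hrel
  have h1 : ∑ u ∈ 𝔊.filter (fun u => U ⊆ u),
      ((#(S.filter (fun s => s ⊆ u)) : ℕ) : ZMod 2) = 1 := by
    calc ∑ u ∈ 𝔊.filter (fun u => U ⊆ u), ((#(S.filter (fun s => s ⊆ u)) : ℕ) : ZMod 2)
        = ∑ u ∈ 𝔊.filter (fun u => U ⊆ u), (if tᶜ ⊆ u then (1 : ZMod 2) else 0) := by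
          refine Finset.sum_congr rfl fun u hu => ?_
          exact hrel u (Finset.mem_filter.1 hu).1
      _ = ∑ u ∈ 𝔊, (if U ∪ tᶜ ⊆ u then (1 : ZMod 2) else 0) := by
          rw [Finset.sum_filter]
          refine Finset.sum_congr rfl fun u _ => ?_
          by_cases hUu : U ⊆ u
          · rw [if_pos hUu]
            by_cases htu : tᶜ ⊆ u
            · rw [if_pos htu, if_pos (Finset.union_subset hUu htu)]
            · rw [if_neg htu, if_neg (fun h => htu (subset_union_right.trans h))]
          · rw [if_neg hUu, if_neg (fun h => hUu (subset_union_left.trans h))]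
      _ = ((#(𝔊.filter (fun u => U ∪ tᶜ ⊆ u)) : ℕ) : ZMod 2) :=
          (card_filter_cast 𝔊 (fun u => U ∪ tᶜ ⊆ u)).symm
      _ = 1 := hodd
  have h2 : ∑ u ∈ 𝔊.filter (fun u => U ⊆ u),
      ((#(S.filter (fun s => s ⊆ u)) : ℕ) : ZMod 2) = 0 := by
    calc ∑ u ∈ 𝔊.filter (fun u => U ⊆ u), ((#(S.filter (fun s => s ⊆ u)) : ℕ) : ZMod 2)
        = ∑ u ∈ 𝔊.filter (fun u => U ⊆ u), ∑ s ∈ S, (if s ⊆ u then (1 : ZMod 2) else 0) := by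
          refine Finset.sum_congr rfl fun u _ => ?_
          exact card_filter_cast S (fun s => s ⊆ u)
      _ = ∑ u ∈ 𝔊, ∑ s ∈ S, (if U ∪ s ⊆ u then (1 : ZMod 2) else 0) := by
          rw [Finset.sum_filter]
          refine Finset.sum_congr rfl fun u _ => ?_
          by_cases hUu : U ⊆ u
          · rw [if_pos hUu]
            refine Finset.sum_congr rfl fun s _ => ?_
            by_cases hsu : s ⊆ u
            · rw [if_pos hsu, if_pos (Finset.union_subset hUu hsu)]
            · rw [if_neg hsu, if_neg (fun h => hsu (subset_union_right.trans h))]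
          · rw [if_neg hUu]
            symm
            refine Finset.sum_eq_zero fun s _ => ?_
            rw [if_neg (fun h => hUu (subset_union_left.trans h))]
      _ = ∑ s ∈ S, ∑ u ∈ 𝔊, (if U ∪ s ⊆ u then (1 : ZMod 2) else 0) := Finset.sum_comm
      _ = ∑ s ∈ S, ((#(𝔊.filter (fun u => U ∪ s ⊆ u)) : ℕ) : ZMod 2) := by
          refine Finset.sum_congr rfl fun s _ => ?_
          exact (card_filter_cast 𝔊 (fun u => U ∪ s ⊆ u)).symm
      _ = 0 := Finset.sum_eq_zero fun s hs => heven s hs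
  rw [h2] at h1
  exact zero_ne_one h1

/-- **Two-filter parity.**  If `W ∪ q₁, W ∪ q₂` are goods of an up-set `𝔊` and every good above `W` contains
`q₁` or `q₂`, then the goods above `W` are the union of two principal filters, so their number is
`[W ∪ q₁ = univ] + [W ∪ q₂ = univ] + [W ∪ q₁ ∪ q₂ = univ]` modulo `2`. [this work, memo §12 (γ)] -/
theorem two_filter_parity (𝔊 : Finset (Finset α))
    (hG : ∀ g ∈ 𝔊, ∀ g' : Finset α, g ⊆ g' → g' ∈ 𝔊)
    (W q₁ q₂ : Finset α) (h₁ : W ∪ q₁ ∈ 𝔊) (h₂ : W ∪ q₂ ∈ 𝔊)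
    (hrel : ∀ g ∈ 𝔊, W ⊆ g → q₁ ⊆ g ∨ q₂ ⊆ g) :
    ((#(𝔊.filter (fun u => W ⊆ u)) : ℕ) : ZMod 2)
      = (if W ∪ q₁ = univ then 1 else 0) + (if W ∪ q₂ = univ then 1 else 0)
        + (if W ∪ q₁ ∪ q₂ = univ then 1 else 0) := by
  set A := 𝔊.filter (fun u => W ∪ q₁ ⊆ u) with hA
  set B := 𝔊.filter (fun u => W ∪ q₂ ⊆ u) with hB
  have hAB : 𝔊.filter (fun u => W ⊆ u) = A ∪ B := by
    ext u
    simp only [hA, hB, Finset.mem_union, Finset.mem_filter, Finset.union_subset_iff]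
    constructor
    · rintro ⟨hu, hWu⟩
      rcases hrel u hu hWu with hq | hq
      · exact Or.inl ⟨hu, hWu, hq⟩
      · exact Or.inr ⟨hu, hWu, hq⟩
    · rintro (⟨hu, hWu, _⟩ | ⟨hu, hWu, _⟩) <;> exact ⟨hu, hWu⟩
  have hAiB : A ∩ B = 𝔊.filter (fun u => W ∪ q₁ ∪ q₂ ⊆ u) := by
    ext u
    simp only [hA, hB, Finset.mem_inter, Finset.mem_filter, Finset.union_subset_iff]
    constructor
    · rintro ⟨⟨hu, hWu, h1u⟩, ⟨_, _, h2u⟩⟩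
      exact ⟨hu, ⟨hWu, h1u⟩, h2u⟩
    · rintro ⟨hu, ⟨hWu, h1u⟩, h2u⟩
      exact ⟨⟨hu, hWu, h1u⟩, ⟨hu, hWu, h2u⟩⟩
  have hcard : #(A ∪ B) + #(A ∩ B) = #A + #B := Finset.card_union_add_card_inter A B
  have hy : ∀ y : ZMod 2, y + y = 0 := by decide
  have hcast : ((#(A ∪ B) : ℕ) : ZMod 2) + ((#(A ∩ B) : ℕ) : ZMod 2)
      = ((#A : ℕ) : ZMod 2) + ((#B : ℕ) : ZMod 2) := by
    rw [← Nat.cast_add, ← Nat.cast_add, hcard]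
  have hval : ((#(A ∪ B) : ℕ) : ZMod 2)
      = ((#A : ℕ) : ZMod 2) + ((#B : ℕ) : ZMod 2) + ((#(A ∩ B) : ℕ) : ZMod 2) := by
    calc ((#(A ∪ B) : ℕ) : ZMod 2)
        = ((#(A ∪ B) : ℕ) : ZMod 2) + (((#(A ∩ B) : ℕ) : ZMod 2) + ((#(A ∩ B) : ℕ) : ZMod 2)) := by
          rw [hy, add_zero]
      _ = (((#(A ∪ B) : ℕ) : ZMod 2) + ((#(A ∩ B) : ℕ) : ZMod 2)) + ((#(A ∩ B) : ℕ) : ZMod 2) := by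
          rw [add_assoc]
      _ = ((#A : ℕ) : ZMod 2) + ((#B : ℕ) : ZMod 2) + ((#(A ∩ B) : ℕ) : ZMod 2) := by rw [hcast]
  rw [hAB, hval, hAiB, hA, hB, card_supersets_parity 𝔊 hG (W ∪ q₁) h₁,
    card_supersets_parity 𝔊 hG (W ∪ q₂) h₂,
    card_supersets_parity 𝔊 hG (W ∪ q₁ ∪ q₂) (hG _ h₁ _ subset_union_left)]

omit [Fintype α] in
/-- Core of a join: `q₁ ∪ q₂ᶜ, q₂ ∪ q₁ᶜ ∈ 𝔊` contain `q₁` resp. `q₂`, hence `a`; so `a ∩ q₂ ⊆ q₁` and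
`a ∩ q₁ ⊆ q₂`. [this work, memo §12 (α)] -/
theorem join_core [Fintype α] (𝔊 : Finset (Finset α)) (q₁ q₂ a : Finset α)
    (h₁₂ : q₁ ∪ q₂ᶜ ∈ 𝔊) (h₂₁ : q₂ ∪ q₁ᶜ ∈ 𝔊)
    (hjoin : ∀ g ∈ 𝔊, a ⊆ g ↔ (q₁ ⊆ g ∨ q₂ ⊆ g)) :
    a ∩ q₂ ⊆ q₁ ∧ a ∩ q₁ ⊆ q₂ := by
  constructor
  · have ha : a ⊆ q₁ ∪ q₂ᶜ := (hjoin _ h₁₂).2 (Or.inl subset_union_left)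
    intro x hx
    rcases Finset.mem_inter.1 hx with ⟨hxa, hx2⟩
    rcases Finset.mem_union.1 (ha hxa) with h | h
    · exact h
    · exact absurd hx2 (Finset.mem_compl.1 h)
  · have ha : a ⊆ q₂ ∪ q₁ᶜ := (hjoin _ h₂₁).2 (Or.inr subset_union_left)
    intro x hx
    rcases Finset.mem_inter.1 hx with ⟨hxa, hx1⟩
    rcases Finset.mem_union.1 (ha hxa) with h | h
    · exact h
    · exact absurd hx1 (Finset.mem_compl.1 h)

/-- In a join, no point of type `8/9` lies above `(t ∪ a)ᶜ`: such an `s` has the goods `s ∪ q₁, s ∪ q₂ ∋ a`,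
so `s ⊇ a \ t` and `s ∪ t = univ`, contradicting COV. [this work, memo §12 (δ)] -/
theorem join_no_top_point (𝒯 : Finset (Finset α)) (θ : Finset α → ℕ)
    (hcov : ∀ s ∈ 𝒯, ∀ s' ∈ 𝒯, s ≠ s' → s ∪ s' ≠ univ)
    (𝔊 : Finset (Finset α))
    (hHH : ∀ s ∈ 𝒯, ∀ s' ∈ 𝒯, s ≠ s' → hhOK (θ s) (θ s') = true → s ∪ s' ∈ 𝔊)
    (q₁ q₂ : Finset α) (hq₁ : q₁ ∈ 𝒯) (hq₂ : q₂ ∈ 𝒯)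
    (hq₁57 : θ q₁ = 5 ∨ θ q₁ = 7) (hq₂57 : θ q₂ = 5 ∨ θ q₂ = 7)
    (t : Finset α) (ht : t ∈ 𝒯) (ht57 : θ t = 5 ∨ θ t = 7) (htq : t = q₁ ∪ q₂)
    (a : Finset α) (hjoin : ∀ g ∈ 𝔊, a ⊆ g ↔ (q₁ ⊆ g ∨ q₂ ⊆ g))
    (s : Finset α) (hs : s ∈ 𝒯) (hs89 : θ s = 8 ∨ θ s = 9) :
    a ∪ s ∪ t ≠ univ := by
  intro huniv
  have hsq₁ : s ≠ q₁ := fun h => by have := congrArg θ h; omega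
  have hsq₂ : s ≠ q₂ := fun h => by have := congrArg θ h; omega
  have hst : s ≠ t := fun h => by have := congrArg θ h; omega
  have ha₁ : a ⊆ s ∪ q₁ :=
    (hjoin _ (hHH s hs q₁ hq₁ hsq₁ (join_table_hh_89_free _ hs89 _ hq₁57))).2 (Or.inl subset_union_right)
  have ha₂ : a ⊆ s ∪ q₂ :=
    (hjoin _ (hHH s hs q₂ hq₂ hsq₂ (join_table_hh_89_free _ hs89 _ hq₂57))).2 (Or.inr subset_union_right)
  apply hcov s hs t ht hst
  refine Finset.eq_univ_iff_forall.2 fun x => ?_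
  have hx := Finset.eq_univ_iff_forall.1 huniv x
  simp only [Finset.mem_union] at hx ⊢
  rcases hx with (hxa | hxs) | hxt
  · rcases Finset.mem_union.1 (ha₁ hxa) with h | h
    · exact Or.inl h
    · exact Or.inr (htq ▸ Finset.mem_union.2 (Or.inl h))
  · exact Or.inl hxs
  · exact Or.inr hxt

/-- **Join dichotomy.**  In a join, a point `s` with `a ∪ s ∪ t = univ` satisfies exactly one of
`a ∪ s ∪ q₁ = univ`, `a ∪ s ∪ q₂ = univ`.  At least one: the good `s ∪ tᶜ ∪ a ∋ a` contains some `q_k`;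
not both: a free `s` would give the COV-violating good `s ∪ a = univ`, an anchored low `s` the good
`a ∪ sᶜ ∋ a ⊇ q_k`, forcing `q_k ⊆ q_{3-k}`; type `8/9` is excluded by `join_no_top_point`. [this work, memo §12 (β),(δ)] -/
theorem join_dichotomy (𝒯 : Finset (Finset α)) (θ : Finset α → ℕ)
    (hθ : ∀ s ∈ 𝒯, 1 ≤ θ s ∧ θ s ≤ 9)
    (hcov : ∀ s ∈ 𝒯, ∀ s' ∈ 𝒯, s ≠ s' → s ∪ s' ≠ univ)
    (𝔊 : Finset (Finset α)) (hG : ∀ g ∈ 𝔊, ∀ g' : Finset α, g ⊆ g' → g' ∈ 𝔊)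
    (hHL : ∀ s ∈ 𝒯, ∀ s' ∈ 𝒯, hlOK (θ s) (θ s') = true → s ∪ s'ᶜ ∈ 𝔊)
    (hHH : ∀ s ∈ 𝒯, ∀ s' ∈ 𝒯, s ≠ s' → hhOK (θ s) (θ s') = true → s ∪ s' ∈ 𝔊)
    (q₁ q₂ : Finset α) (hq₁ : q₁ ∈ 𝒯) (hq₂ : q₂ ∈ 𝒯)
    (hq₁57 : θ q₁ = 5 ∨ θ q₁ = 7) (hq₂57 : θ q₂ = 5 ∨ θ q₂ = 7)
    (hinc₁ : ¬ q₁ ⊆ q₂) (hinc₂ : ¬ q₂ ⊆ q₁)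
    (t : Finset α) (ht : t ∈ 𝒯) (ht57 : θ t = 5 ∨ θ t = 7) (htq : t = q₁ ∪ q₂)
    (a : Finset α) (ha : a ∈ 𝒯) (ha89 : θ a = 8 ∨ θ a = 9)
    (hjoin : ∀ g ∈ 𝔊, a ⊆ g ↔ (q₁ ⊆ g ∨ q₂ ⊆ g))
    (s : Finset α) (hs : s ∈ 𝒯) (huniv : a ∪ s ∪ t = univ) :
    (a ∪ s ∪ q₁ = univ ∧ a ∪ s ∪ q₂ ≠ univ) ∨ (a ∪ s ∪ q₁ ≠ univ ∧ a ∪ s ∪ q₂ = univ) := by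
  have hcore := join_core 𝔊 q₁ q₂ a
    (hHL q₁ hq₁ q₂ hq₂ (table_hl_low_free (θ q₁) (by omega) (by omega) (θ q₂) hq₂57))
    (hHL q₂ hq₂ q₁ hq₁ (table_hl_low_free (θ q₂) (by omega) (by omega) (θ q₁) hq₁57)) hjoin
  have hθs := hθ s hs
  -- type 8/9 is impossible
  have hs7 : θ s ≤ 7 := by
    by_contra h
    exact join_no_top_point 𝒯 θ hcov 𝔊 hHH q₁ q₂ hq₁ hq₂ hq₁57 hq₂57 t ht ht57 htq a hjoin s hs
      (by omega) huniv
  -- at least one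
  have hone : a ∪ s ∪ q₁ = univ ∨ a ∪ s ∪ q₂ = univ := by
    have hg : s ∪ tᶜ ∪ a ∈ 𝔊 :=
      hG _ (hHL s hs t ht (table_hl_low_free (θ s) hθs.1 hs7 (θ t) ht57)) _ subset_union_left
    have hx := Finset.eq_univ_iff_forall.1 huniv
    rcases (hjoin _ hg).1 subset_union_right with hq | hq
    · right
      refine Finset.eq_univ_iff_forall.2 fun x => ?_
      have hx := hx x
      simp only [Finset.mem_union] at hx ⊢
      rcases hx with (hxa | hxs) | hxt
      · exact Or.inl (Or.inl hxa)
      · exact Or.inl (Or.inr hxs)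
      · rcases Finset.mem_union.1 (htq ▸ hxt) with hx1 | hx2
        · rcases Finset.mem_union.1 (hq hx1) with h | h
          · rcases Finset.mem_union.1 h with h | h
            · exact Or.inl (Or.inr h)
            · exact absurd hxt (Finset.mem_compl.1 h)
          · exact Or.inl (Or.inl h)
        · exact Or.inr hx2
    · left
      refine Finset.eq_univ_iff_forall.2 fun x => ?_
      have hx := hx x
      simp only [Finset.mem_union] at hx ⊢
      rcases hx with (hxa | hxs) | hxt
      · exact Or.inl (Or.inl hxa)
      · exact Or.inl (Or.inr hxs)
      · rcases Finset.mem_union.1 (htq ▸ hxt) with hx1 | hx2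
        · exact Or.inr hx1
        · rcases Finset.mem_union.1 (hq hx2) with h | h
          · rcases Finset.mem_union.1 h with h | h
            · exact Or.inl (Or.inr h)
            · exact absurd hxt (Finset.mem_compl.1 h)
          · exact Or.inl (Or.inl h)
  -- not both
  have hnotboth : ¬ (a ∪ s ∪ q₁ = univ ∧ a ∪ s ∪ q₂ = univ) := by
    rintro ⟨hP₁, hP₂⟩
    have hP₁x := Finset.eq_univ_iff_forall.1 hP₁
    have hP₂x := Finset.eq_univ_iff_forall.1 hP₂
    by_cases hsf : θ s = 5 ∨ θ s = 7
    · -- free point: the good `s ∪ a ∋ a` contains some `q_k`, and then `s ∪ a = univ`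
      have hsa : s ≠ a := fun h => by have := congrArg θ h; omega
      have hg : s ∪ a ∈ 𝔊 := hHH s hs a ha hsa (table_twins_pair (θ s) hsf (θ a) ha89).1
      apply hcov s hs a ha hsa
      refine Finset.eq_univ_iff_forall.2 fun x => ?_
      rcases (hjoin _ hg).1 subset_union_right with hq | hq
      · have hx := hP₁x x
        simp only [Finset.mem_union] at hx ⊢
        rcases hx with (hxa | hxs) | hx1
        · exact Or.inr hxa
        · exact Or.inl hxs
        · exact Finset.mem_union.1 (hq hx1)
      · have hx := hP₂x x
        simp only [Finset.mem_union] at hx ⊢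
        rcases hx with (hxa | hxs) | hx2
        · exact Or.inr hxa
        · exact Or.inl hxs
        · exact Finset.mem_union.1 (hq hx2)
    · -- anchored low point: the good `a ∪ sᶜ ∋ a` contains some `q_k`, forcing `q_k ⊆ q_{3-k}`
      have hg : a ∪ sᶜ ∈ 𝔊 :=
        hHL a ha s hs (join_table_hl_89_low (θ a) ha89 (θ s) hθs.1 hs7 (by omega) (by omega))
      rcases (hjoin _ hg).1 subset_union_left with hq | hq
      · apply hinc₁
        intro x hx1
        rcases Finset.mem_union.1 (hq hx1) with hxa | hxs
        · exact hcore.2 (Finset.mem_inter.2 ⟨hxa, hx1⟩)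
        · have hx := hP₂x x
          simp only [Finset.mem_union] at hx
          rcases hx with (hxa | hxs') | hx2
          · exact hcore.2 (Finset.mem_inter.2 ⟨hxa, hx1⟩)
          · exact absurd hxs' (Finset.mem_compl.1 hxs)
          · exact hx2
      · apply hinc₂
        intro x hx2
        rcases Finset.mem_union.1 (hq hx2) with hxa | hxs
        · exact hcore.1 (Finset.mem_inter.2 ⟨hxa, hx2⟩)
        · have hx := hP₁x x
          simp only [Finset.mem_union] at hx
          rcases hx with (hxa | hxs') | hx1
          · exact hcore.1 (Finset.mem_inter.2 ⟨hxa, hx2⟩)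
          · exact absurd hxs' (Finset.mem_compl.1 hxs)
          · exact hx1
  rcases hone with h | h
  · exact Or.inl ⟨h, fun h' => hnotboth ⟨h, h'⟩⟩
  · exact Or.inr ⟨fun h' => hnotboth ⟨h', h⟩, h⟩

/-- **Join lemma** (fifth circuit class of conjecture K1, memo §12): in a join
`a ⊆ g ↔ (q₁ ⊆ g ∨ q₂ ⊆ g)` (`q₁, q₂` free and incomparable, `t = q₁ ∪ q₂ ∈ 𝒯` free, `a` of type `8/9`),
the L-row of the top `t` is not a `GF(2)`-combination of H-rows: no family `S ⊆ 𝒯` satisfies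
`#{s ∈ S : s ⊆ g} ≡ [tᶜ ⊆ g] (mod 2)` for every good `g`.  Certificate: the H-row of `a`
(`parity_certificate` with `U = a`, evaluated by `two_filter_parity` and `join_dichotomy`). [this work] -/
theorem join_L_row_not_H_combination (𝒯 : Finset (Finset α)) (θ : Finset α → ℕ)
    (hθ : ∀ s ∈ 𝒯, 1 ≤ θ s ∧ θ s ≤ 9)
    (hcov : ∀ s ∈ 𝒯, ∀ s' ∈ 𝒯, s ≠ s' → s ∪ s' ≠ univ)
    (𝔊 : Finset (Finset α)) (hG : ∀ g ∈ 𝔊, ∀ g' : Finset α, g ⊆ g' → g' ∈ 𝔊)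
    (hHL : ∀ s ∈ 𝒯, ∀ s' ∈ 𝒯, hlOK (θ s) (θ s') = true → s ∪ s'ᶜ ∈ 𝔊)
    (hHH : ∀ s ∈ 𝒯, ∀ s' ∈ 𝒯, s ≠ s' → hhOK (θ s) (θ s') = true → s ∪ s' ∈ 𝔊)
    (q₁ q₂ : Finset α) (hq₁ : q₁ ∈ 𝒯) (hq₂ : q₂ ∈ 𝒯)
    (hq₁57 : θ q₁ = 5 ∨ θ q₁ = 7) (hq₂57 : θ q₂ = 5 ∨ θ q₂ = 7)
    (hinc₁ : ¬ q₁ ⊆ q₂) (hinc₂ : ¬ q₂ ⊆ q₁)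
    (t : Finset α) (ht : t ∈ 𝒯) (ht57 : θ t = 5 ∨ θ t = 7) (htq : t = q₁ ∪ q₂)
    (a : Finset α) (ha : a ∈ 𝒯) (ha89 : θ a = 8 ∨ θ a = 9)
    (hjoin : ∀ g ∈ 𝔊, a ⊆ g ↔ (q₁ ⊆ g ∨ q₂ ⊆ g))
    (S : Finset (Finset α)) (hS : S ⊆ 𝒯) :
    ¬ (∀ g ∈ 𝔊, ((#(S.filter (fun s => s ⊆ g)) : ℕ) : ZMod 2) = if tᶜ ⊆ g then 1 else 0) := by
  have hcore := join_core 𝔊 q₁ q₂ a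
    (hHL q₁ hq₁ q₂ hq₂ (table_hl_low_free (θ q₁) (by omega) (by omega) (θ q₂) hq₂57))
    (hHL q₂ hq₂ q₁ hq₁ (table_hl_low_free (θ q₂) (by omega) (by omega) (θ q₁) hq₁57)) hjoin
  have hq₁a : q₁ ≠ a := fun h => by have := congrArg θ h; omega
  have hq₂a : q₂ ≠ a := fun h => by have := congrArg θ h; omega
  have hg₁ : a ∪ q₁ ∈ 𝔊 := hHH a ha q₁ hq₁ hq₁a.symm (join_table_hh_89_free (θ a) ha89 (θ q₁) hq₁57)
  have hg₂ : a ∪ q₂ ∈ 𝔊 := hHH a ha q₂ hq₂ hq₂a.symm (join_table_hh_89_free (θ a) ha89 (θ q₂) hq₂57)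
  -- the two-filter evaluation of `#{g ∈ 𝔊 : a ∪ u ⊆ g}` for any `u`
  have heval : ∀ u : Finset α, ((#(𝔊.filter (fun g => a ∪ u ⊆ g)) : ℕ) : ZMod 2)
      = (if a ∪ u ∪ q₁ = univ then 1 else 0) + (if a ∪ u ∪ q₂ = univ then 1 else 0)
        + (if a ∪ u ∪ q₁ ∪ q₂ = univ then 1 else 0) := by
    intro u
    refine two_filter_parity 𝔊 hG (a ∪ u) q₁ q₂ ?_ ?_ ?_
    · exact hG _ hg₁ _ (Finset.union_subset_union subset_union_left (subset_refl q₁))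
    · exact hG _ hg₂ _ (Finset.union_subset_union subset_union_left (subset_refl q₂))
    · intro g hg hWg
      exact (hjoin g hg).1 (subset_union_left.trans hWg)
  refine parity_certificate 𝔊 a t S ?_ ?_
  · -- odd: `a ∪ tᶜ ∪ q_k ≠ univ` (it misses `q_{3-k} \ q_k`), `a ∪ tᶜ ∪ q₁ ∪ q₂ = univ`
    rw [heval tᶜ]
    obtain ⟨x₂, hx₂q₂, hx₂q₁⟩ := Finset.not_subset.1 hinc₂
    obtain ⟨x₁, hx₁q₁, hx₁q₂⟩ := Finset.not_subset.1 hinc₁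
    have hn₁ : a ∪ tᶜ ∪ q₁ ≠ univ := by
      intro h
      have hx := Finset.eq_univ_iff_forall.1 h x₂
      simp only [Finset.mem_union, Finset.mem_compl] at hx
      rcases hx with (hxa | hxt) | hx1
      · exact hx₂q₁ (hcore.1 (Finset.mem_inter.2 ⟨hxa, hx₂q₂⟩))
      · exact hxt (htq ▸ Finset.mem_union.2 (Or.inr hx₂q₂))
      · exact hx₂q₁ hx1
    have hn₂ : a ∪ tᶜ ∪ q₂ ≠ univ := by
      intro h
      have hx := Finset.eq_univ_iff_forall.1 h x₁
      simp only [Finset.mem_union, Finset.mem_compl] at hx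
      rcases hx with (hxa | hxt) | hx2
      · exact hx₁q₂ (hcore.2 (Finset.mem_inter.2 ⟨hxa, hx₁q₁⟩))
      · exact hxt (htq ▸ Finset.mem_union.2 (Or.inl hx₁q₁))
      · exact hx₁q₂ hx2
    have hy : a ∪ tᶜ ∪ q₁ ∪ q₂ = univ := by
      refine Finset.eq_univ_iff_forall.2 fun x => ?_
      simp only [Finset.mem_union, Finset.mem_compl]
      by_cases hxt : x ∈ t
      · rcases Finset.mem_union.1 (htq ▸ hxt) with h | h
        · exact Or.inl (Or.inr h)
        · exact Or.inr h
      · exact Or.inl (Or.inl (Or.inr hxt))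
    rw [if_neg hn₁, if_neg hn₂, if_pos hy]
    decide
  · -- even: by the dichotomy
    intro s hs
    rw [heval s]
    have hassoc : a ∪ s ∪ q₁ ∪ q₂ = a ∪ s ∪ t := by rw [htq, Finset.union_assoc]
    rw [hassoc]
    by_cases huniv : a ∪ s ∪ t = univ
    · rw [if_pos huniv]
      rcases join_dichotomy 𝒯 θ hθ hcov 𝔊 hG hHL hHH q₁ q₂ hq₁ hq₂ hq₁57 hq₂57 hinc₁ hinc₂ t ht ht57 htq
          a ha ha89 hjoin s (hS hs) huniv with ⟨h₁, h₂⟩ | ⟨h₁, h₂⟩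
      · rw [if_pos h₁, if_neg h₂]
        decide
      · rw [if_neg h₁, if_pos h₂]
        decide
    · have hmono : ∀ q : Finset α, q ⊆ t → a ∪ s ∪ q ≠ univ := fun q hq h =>
        huniv (Finset.univ_subset_iff.1
          (le_trans h.symm.le (Finset.union_subset_union (subset_refl (a ∪ s)) hq)))
      rw [if_neg (hmono q₁ (by rw [htq]; exact subset_union_left)),
        if_neg (hmono q₂ (by rw [htq]; exact subset_union_right)), if_neg huniv]
      decide

end NineType

end Summit.CriticalPhenomena.PercolationContinuityZ3.Theorems
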